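import Literature.NumberTheory.ComplexMultiplication.CMTypeRankCommonConstituent
import Literature.NumberTheory.ComplexMultiplication.CMTypeRankMultiplicityOne
import HarnessLib

/-!
# An irreducible slot against a small or reducible slot has no common constituent; pair flips make a slot irreducible

Companion of `NumberTheory/ComplexMultiplication/CMTypeRankCommonConstituent` (setting: a group `G` acting slot by
slot on `⊔_i E_i` = Deligne's `Hom(∏_i K_i, ℂ)`, CM types `Φ_i ⊆ E_i` for a commuting conjugation `ρ`, Shimura's
antisymmetric spans `U(Φ_i) = antiSpan G (Φ_i)`, the family type `Σ = sigmaType Φ`; rank additivity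
`U(Σ) = ⊕_i U(Φ_i)` — on Hodge groups `Hg(∏_i A_i) = ∏_i Hg(A_i)` — follows from the PAIRWISE absence of common
constituents, `map_slotExt_antiSpan_le_of_pairwise`) and of `CMTypeRankTypeConjugation` §2 (stabiliser separation,
which asks that `U(Φ_{i₁})` be IRREDUCIBLE: no `G`-stable subspace other than `0` and itself).  Two elementary
supplements, both finite-dimensional linear algebra over `ℚ`:

* §1 **Pair flips make a slot irreducible.**  If `G` is transitive on `X` and every pair `{x, ρx}` is FLIPPED by some
  `φ ∈ G` fixing the other points of `X` (`φx = ρx`, `φy = y` for `y ∉ {x, ρx}`), then every non-zero `G`-stable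
  subspace of the `ρ`-odd weights is all of them (`eq_antiWeights_of_stable_of_pairFlip`: `f − f∘φ_x = 2f(x)·(δ_x − δ_{ρx})`,
  and the `δ_y − δ_{ρy}` span the odd weights); hence for every CM type `Φ ⊆ X`: `U(Φ) = Anti`
  (`antiSpan_eq_antiWeights_of_pairFlip`), `rank(Φ) = |X|/2 + 1` (`typeRank_eq_of_pairFlip`: EVERY type is
  nondegenerate) and `U(Φ)` is irreducible (`antiSpan_irreducible_of_pairFlip`) — the abstract form of the pair-flip
  CM fields of `Summits/…/CorCM/GenericCMFieldTypes` (sextic CM fields with Galois closure of degree `24`/`48`).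
* §2 **An irreducible slot against a small or reducible slot.**  If `U(Φ_j)` is irreducible, `dim U(Φ_i) ≤ dim U(Φ_j)`,
  and in case of equality `U(Φ_i)` has a proper non-zero `G`-stable subspace, then the pair `(i, j)` has NO COMMON
  CONSTITUENT in either direction (`pairwise_of_irreducible_of_finrank_le`): an equivariant injection from a stable
  `P ≤ U(Φ_i)` into `U(Φ_j)` has stable non-zero image, hence image `U(Φ_j)`, forcing `P = U(Φ_i) ≅ U(Φ_j)`
  irreducible — contradicting the proper stable subspace; symmetrically for `P ≤ U(Φ_j)`.  A `G`-EIGENVECTOR in a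
  space of dimension `≥ 2` spans such a proper stable subspace (`exists_proper_stable_of_eigenvector`; for CM fields:
  the sign vector of an imaginary quadratic subfield).  Two-slot corollaries `typeRank_sigmaType_add_card_eq_of_irreducible_pair`,
  `typeRank_sigmaType_eq_iff_forall_of_irreducible_pair` (`rank(Φ₀, Φ₁) − 1 = (rank Φ₀ − 1) + (rank Φ₁ − 1)`).

Use (CorCM, pairs of simple CM threefolds): a sextic CM field with pair flips against a CM field of degree `≤ 4`
(`dim U ≤ 2 < 3`) or against a sextic CM field with an imaginary quadratic subfield (the eigenline) — `Hg(A₀ × A₁) =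
Hg(A₀) × Hg(A₁)` with no condition relating the two fields.  Theorems only: no definition, no named fact, no `sorry`.

## References

* [Gordon1999HodgeAVSurvey] B. B. Gordon, *A survey of the Hodge conjecture for abelian varieties*, §3 Theorem (proof),
  7.5–7.7.
* [Serre1977] J.-P. Serre, *Linear Representations of Finite Groups*, GTM 42, §1.3–§2.2 (stable subspaces, Schur).
* [Dodson1984] B. Dodson, *The structure of Galois groups of CM-fields*, Trans. AMS 283 (1984), §5.1 (sign changes in
  the imprimitive Galois group `(ℤ/2)ⁿ ⋊ H`).
-/

set_option autoImplicit false

namespace Literature.NumberTheory.ComplexMultiplication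

variable {G : Type*} [Group G]

/-! ### §1 Pair flips: the odd weights are irreducible -/

section PairFlip

variable {X : Type*} [MulAction G X]

/-- Membership in the `ρ`-odd weights `f(ρx) = −f(x)` (Kubota's anti-invariant part of `P(G)^Φ`). [cite: Kubota1965, §2 (p. 115)] -/
theorem mem_antiWeights_iff' {ρ : G} {f : X → ℚ} : f ∈ antiWeights (E := X) ρ ↔ ∀ x, f (ρ • x) = -f x :=
  Iff.rfl

variable [DecidableEq X]

/-- The elementary odd vectors `δ_y − δ_{ρy}` are odd (`ρ` an involution on `X`) — Shimura's `ζ − ζρ`.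
[cite: Shimura1998, §32.10 (proof)] -/
theorem single_sub_single_mem_antiWeights {ρ : G} (hρ : ∀ x : X, ρ • ρ • x = x) (y : X) :
    (Pi.single y (1 : ℚ) - Pi.single (ρ • y) 1 : X → ℚ) ∈ antiWeights (E := X) ρ := by
  rw [mem_antiWeights_iff']
  intro x
  have h1 : (ρ • x = ρ • y) ↔ x = y := ⟨fun h => by simpa [hρ] using congrArg (ρ • ·) h, fun h => by rw [h]⟩
  have h2 : (ρ • x = y) ↔ x = ρ • y := ⟨fun h => by rw [← h, hρ], fun h => by rw [h, hρ]⟩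
  simp only [Pi.sub_apply, Pi.single_apply, h1, h2]
  ring

/-- `(δ_x − δ_{ρx}) ∘ k = δ_{k⁻¹x} − δ_{ρk⁻¹x}`: precomposition by `k ∈ G` permutes the elementary odd vectors (the
Galois action on `ℤ[φ₁, φ̄₁, …, φₙ, φ̄ₙ]`). [cite: Dodson1987, §1.1 (p. 50)] -/
theorem single_sub_single_comp_smul {ρ : G} (hcomm : ∀ (g : G) (x : X), g • ρ • x = ρ • g • x) (x : X) (k : G) :
    (fun z => (Pi.single x (1 : ℚ) - Pi.single (ρ • x) 1 : X → ℚ) (k • z)) =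
      (Pi.single (k⁻¹ • x) (1 : ℚ) - Pi.single (ρ • k⁻¹ • x) 1 : X → ℚ) := by
  funext z
  simp only [Pi.sub_apply, Pi.single_apply]
  have h1 : (k • z = x) ↔ (z = k⁻¹ • x) := by rw [eq_inv_smul_iff]
  have h2 : (k • z = ρ • x) ↔ (z = ρ • k⁻¹ • x) := by rw [← hcomm k⁻¹ x, eq_inv_smul_iff]
  simp only [h1, h2]

/-- **`f − f∘φ = 2f(x)·(δ_x − δ_{ρx})` for an odd weight `f` and a pair flip `φ` at `x`** (`φx = ρx`, `φ` trivial
off `{x, ρx}`). [cite: Gordon1999HodgeAVSurvey, §3 Theorem (proof)] -/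
theorem sub_comp_pairFlip_eq {ρ : G} (hρ : ∀ x : X, ρ • ρ • x = x)
    (hcomm : ∀ (g : G) (x : X), g • ρ • x = ρ • g • x) (hfree : ∀ x : X, ρ • x ≠ x) {f : X → ℚ}
    (hf : f ∈ antiWeights (E := X) ρ) {x : X} {φ : G} (hφx : φ • x = ρ • x)
    (hφ : ∀ y : X, y ≠ x → y ≠ ρ • x → φ • y = y) :
    (f - fun y => f (φ • y)) = (2 * f x) • (Pi.single x (1 : ℚ) - Pi.single (ρ • x) 1 : X → ℚ) := by
  rw [mem_antiWeights_iff'] at hf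
  have hφρx : φ • ρ • x = x := by rw [hcomm, hφx, hρ]
  funext z
  simp only [Pi.sub_apply, Pi.smul_apply, Pi.single_apply, smul_eq_mul]
  by_cases hzx : z = x
  · subst hzx
    have hz : ¬ (z = ρ • z) := fun h => hfree z h.symm
    simp only [hφx, hf z, if_true, hz, if_false]
    ring
  · by_cases hzρ : z = ρ • x
    · subst hzρ
      simp only [hφρx, hf x, hzx, if_false, if_true]
      ring
    · simp only [hφ z hzx hzρ, hzx, hzρ, if_false]
      ring

variable [Fintype X]

/-- **An odd weight is `½ Σ_y f(y)·(δ_y − δ_{ρy})`**: the `ζ − ζρ` span the anti-invariant weights.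
[cite: Shimura1998, §32.10 (proof)] -/
theorem eq_sum_smul_single_sub_of_mem_antiWeights {ρ : G} (hρ : ∀ x : X, ρ • ρ • x = x) {f : X → ℚ}
    (hf : f ∈ antiWeights (E := X) ρ) :
    f = (1 / 2 : ℚ) • ∑ y, f y • (Pi.single y (1 : ℚ) - Pi.single (ρ • y) 1 : X → ℚ) := by
  rw [mem_antiWeights_iff'] at hf
  funext z
  have h2 : ∀ y : X, (z = ρ • y) ↔ (y = ρ • z) :=
    fun y => ⟨fun h => by rw [h, hρ], fun h => by rw [h, hρ]⟩
  simp only [Pi.smul_apply, Finset.sum_apply, Pi.sub_apply, Pi.single_apply, smul_eq_mul, mul_sub,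
    Finset.sum_sub_distrib, mul_ite, mul_one, mul_zero]
  simp_rw [h2]
  rw [Finset.sum_ite_eq Finset.univ z (fun y => f y), Finset.sum_ite_eq' Finset.univ (ρ • z) (fun y => f y)]
  simp only [Finset.mem_univ, if_true, hf z]
  ring

/-- **Pair flips make the odd weights irreducible.**  Let `G` act transitively on `X`, `ρ ∈ G` a commuting
fixed-point-free involution, and suppose every pair `{x, ρx}` is flipped by some `φ ∈ G` trivial off the pair.  Then
every non-zero `G`-stable subspace `W` of the `ρ`-odd weights IS the odd weights: `W ∋ f ≠ 0` gives
`δ_x − δ_{ρx} ∈ W` for some `x` (`f − f∘φ_x`), then for all `x` (transitivity), and these span the odd weights.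
[cite: Serre1977, §1.3] [cite: Dodson1984, §5.1] -/
theorem eq_antiWeights_of_stable_of_pairFlip [MulAction.IsPretransitive G X] {ρ : G}
    (hρ : ∀ x : X, ρ • ρ • x = x) (hcomm : ∀ (g : G) (x : X), g • ρ • x = ρ • g • x)
    (hfree : ∀ x : X, ρ • x ≠ x)
    (hflip : ∀ x : X, ∃ φ : G, φ • x = ρ • x ∧ ∀ y : X, y ≠ x → y ≠ ρ • x → φ • y = y)
    {W : Submodule ℚ (X → ℚ)} (hW : W ≤ antiWeights (E := X) ρ) (hW0 : W ≠ ⊥)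
    (hst : ∀ (g : G) (f : X → ℚ), f ∈ W → (fun y => f (g • y)) ∈ W) :
    W = antiWeights (E := X) ρ := by
  obtain ⟨f, hfW, hf0⟩ := (Submodule.ne_bot_iff W).1 hW0
  obtain ⟨x, hx⟩ : ∃ x, f x ≠ 0 := by
    by_contra h
    exact hf0 (funext fun x => by simpa using (not_exists.1 h) x)
  obtain ⟨φ, hφx, hφ⟩ := hflip x
  -- `δ_x − δ_{ρx} ∈ W`
  have hdx : (Pi.single x (1 : ℚ) - Pi.single (ρ • x) 1 : X → ℚ) ∈ W := by
    have h1 : (f - fun y => f (φ • y)) ∈ W := W.sub_mem hfW (hst φ f hfW)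
    rw [sub_comp_pairFlip_eq hρ hcomm hfree (hW hfW) hφx hφ] at h1
    exact (Submodule.smul_mem_iff W (mul_ne_zero two_ne_zero hx)).1 h1
  -- hence `δ_y − δ_{ρy} ∈ W` for all `y`
  have hdy : ∀ y : X, (Pi.single y (1 : ℚ) - Pi.single (ρ • y) 1 : X → ℚ) ∈ W := by
    intro y
    obtain ⟨k, hk⟩ := MulAction.exists_smul_eq G y x
    have h1 := hst k _ hdx
    rw [single_sub_single_comp_smul hcomm x k, ← hk, inv_smul_smul] at h1
    exact h1
  refine le_antisymm hW fun g hg => ?_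
  rw [eq_sum_smul_single_sub_of_mem_antiWeights hρ hg]
  exact W.smul_mem _ (W.sum_mem fun y _ => W.smul_mem _ (hdy y))

variable [Nonempty X]

/-- **`U(Φ) = Anti` for every CM type of a pair-flip slot** (the translates of `u_Φ` span the odd weights).
[cite: Dodson1984, §5.1] -/
theorem antiSpan_eq_antiWeights_of_pairFlip [MulAction.IsPretransitive G X] {ρ : G} {Φ : Set X}
    (h : IsCMTypeWith ρ Φ)
    (hflip : ∀ x : X, ∃ φ : G, φ • x = ρ • x ∧ ∀ y : X, y ≠ x → y ≠ ρ • x → φ • y = y) :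
    antiSpan G Φ = antiWeights (E := X) ρ := by
  refine eq_antiWeights_of_stable_of_pairFlip h.invol h.comm h.rho_smul_ne hflip (antiSpan_le_antiWeights' h)
    ?_ (fun g f hf => comp_smul_mem_antiSpan hf g)
  rw [Submodule.ne_bot_iff]
  refine ⟨antiVec Φ (1 : G), Submodule.subset_span ⟨1, rfl⟩, fun h0 => ?_⟩
  have h1 := congrFun h0 (Classical.arbitrary X)
  simp only [antiVec, Pi.zero_apply] at h1
  by_cases hm : (1 : G) • Classical.arbitrary X ∈ Φ
  · rw [translateInd_of_mem hm] at h1; norm_num at h1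
  · rw [translateInd_of_not_mem hm] at h1; norm_num at h1

/-- **Every CM type of a pair-flip slot is nondegenerate**: `rank(Φ) = |X|/2 + 1`. [cite: Dodson1984, §5.1] -/
theorem typeRank_eq_of_pairFlip [MulAction.IsPretransitive G X] {ρ : G} {Φ : Set X} (h : IsCMTypeWith ρ Φ)
    (hflip : ∀ x : X, ∃ φ : G, φ • x = ρ • x ∧ ∀ y : X, y ≠ x → y ≠ ρ • x → φ • y = y) :
    typeRank G Φ = Fintype.card X / 2 + 1 :=
  h.typeRank_eq_iff_antiSpan_eq.2 (antiSpan_eq_antiWeights_of_pairFlip h hflip)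

/-- **`U(Φ)` is irreducible for every CM type of a pair-flip slot**: a non-zero `G`-stable subspace of `U(Φ)` is
`U(Φ)` (the hypothesis `hirr` of `CMTypeRankTypeConjugation`'s stabiliser separation). [cite: Serre1977, §1.3] -/
theorem antiSpan_irreducible_of_pairFlip [MulAction.IsPretransitive G X] {ρ : G} {Φ : Set X}
    (h : IsCMTypeWith ρ Φ)
    (hflip : ∀ x : X, ∃ φ : G, φ • x = ρ • x ∧ ∀ y : X, y ≠ x → y ≠ ρ • x → φ • y = y)
    (W : Submodule ℚ (X → ℚ)) (hW : W ≤ antiSpan G Φ) (hW0 : W ≠ ⊥)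
    (hst : ∀ (k : G) (f : X → ℚ), f ∈ W → (fun y => f (k • y)) ∈ W) : W = antiSpan G Φ := by
  rw [antiSpan_eq_antiWeights_of_pairFlip h hflip] at hW ⊢
  exact eq_antiWeights_of_stable_of_pairFlip h.invol h.comm h.rho_smul_ne hflip hW hW0 hst

end PairFlip

/-! ### §2 An irreducible slot against a small or reducible slot: no common constituent -/

section Irreducible

variable {X : Type*} [MulAction G X]

/-- **A `G`-eigenvector spans a proper non-zero stable subspace** of any stable space of dimension `≥ 2` containing
it (for CM fields: the sign vector `x ↦ ±1` of an imaginary quadratic subfield inside the odd weights).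
[cite: Serre1977, §2.2] -/
theorem exists_proper_stable_of_eigenvector {U : Submodule ℚ (X → ℚ)} {e : X → ℚ} (he : e ∈ U) (he0 : e ≠ 0)
    (heig : ∀ k : G, ∃ c : ℚ, (fun y => e (k • y)) = c • e) (hU : 2 ≤ Module.finrank ℚ U) :
    ∃ W : Submodule ℚ (X → ℚ), W ≤ U ∧ W ≠ ⊥ ∧ W ≠ U ∧
      ∀ (k : G) (f : X → ℚ), f ∈ W → (fun y => f (k • y)) ∈ W := by
  refine ⟨ℚ ∙ e, (Submodule.span_singleton_le_iff_mem _ _).2 he, ?_, ?_, fun k f hf => ?_⟩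
  · rw [Ne, Submodule.span_singleton_eq_bot]
    exact he0
  · intro hWU
    have h1 : Module.finrank ℚ (ℚ ∙ e) = 1 := finrank_span_singleton he0
    rw [hWU] at h1
    omega
  · obtain ⟨a, rfl⟩ := Submodule.mem_span_singleton.1 hf
    obtain ⟨c, hc⟩ := heig k
    refine Submodule.mem_span_singleton.2 ⟨a * c, ?_⟩
    funext y
    have := congrFun hc y
    simp only [Pi.smul_apply, smul_eq_mul] at this ⊢
    rw [this]
    ring

variable {I : Type*} {E : I → Type*} [∀ i, MulAction G (E i)] [∀ i, Fintype (E i)]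

/-- **An irreducible slot against a small or reducible slot: no common constituent, both directions.**  If `U(Φ_j)`
has no `G`-stable subspace other than `0` and itself, `dim U(Φ_i) ≤ dim U(Φ_j)`, and — should the dimensions agree —
`U(Φ_i)` has a proper non-zero stable subspace, then every stable `P ≤ U(Φ_i)` with an equivariant injection into
`U(Φ_j)` is zero, and every stable `P ≤ U(Φ_j)` with an equivariant injection into `U(Φ_i)` is zero (Schur-type
dimension count with stable images and preimages; no complete reducibility needed).
[cite: Serre1977, §2.2 Prop. 4 (proof)] [cite: Gordon1999HodgeAVSurvey, §3 Theorem (proof)] -/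
theorem pairwise_of_irreducible_of_finrank_le {Φ : ∀ i, Set (E i)} {i j : I}
    (hirr : ∀ W : Submodule ℚ (E j → ℚ), W ≤ antiSpan G (Φ j) → W ≠ ⊥ →
      (∀ (k : G) (f : E j → ℚ), f ∈ W → (fun y => f (k • y)) ∈ W) → W = antiSpan G (Φ j))
    (hle : Module.finrank ℚ (antiSpan G (Φ i)) ≤ Module.finrank ℚ (antiSpan G (Φ j)))
    (hred : Module.finrank ℚ (antiSpan G (Φ i)) = Module.finrank ℚ (antiSpan G (Φ j)) →
      ∃ W : Submodule ℚ (E i → ℚ), W ≤ antiSpan G (Φ i) ∧ W ≠ ⊥ ∧ W ≠ antiSpan G (Φ i) ∧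
        ∀ (k : G) (f : E i → ℚ), f ∈ W → (fun y => f (k • y)) ∈ W) :
    (∀ P : Submodule ℚ (E i → ℚ), P ≤ antiSpan G (Φ i) →
      (∀ g : G, ∀ f ∈ P, (fun x => f (g • x)) ∈ P) →
      ∀ T : (E i → ℚ) →ₗ[ℚ] (E j → ℚ),
        (∀ g : G, ∀ f ∈ P, T (fun x => f (g • x)) = fun y => T f (g • y)) →
        (∀ f ∈ P, T f ∈ antiSpan G (Φ j)) → (∀ f ∈ P, T f = 0 → f = 0) → P = ⊥) ∧
    (∀ P : Submodule ℚ (E j → ℚ), P ≤ antiSpan G (Φ j) →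
      (∀ g : G, ∀ f ∈ P, (fun x => f (g • x)) ∈ P) →
      ∀ T : (E j → ℚ) →ₗ[ℚ] (E i → ℚ),
        (∀ g : G, ∀ f ∈ P, T (fun x => f (g • x)) = fun y => T f (g • y)) →
        (∀ f ∈ P, T f ∈ antiSpan G (Φ i)) → (∀ f ∈ P, T f = 0 → f = 0) → P = ⊥) := by
  constructor
  · intro P hP hPst T hT hTU hTinj
    by_contra hP0
    -- every non-zero stable `W ≤ P` maps ONTO `U(Φ_j)`
    have key : ∀ W : Submodule ℚ (E i → ℚ), W ≤ P → W ≠ ⊥ →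
        (∀ (k : G) (f : E i → ℚ), f ∈ W → (fun y => f (k • y)) ∈ W) → W.map T = antiSpan G (Φ j) := by
      intro W hWP hW0 hWst
      refine hirr _ (fun g hg => ?_) ?_ (fun k g hg => ?_)
      · obtain ⟨f, hf, rfl⟩ := hg
        exact hTU f (hWP hf)
      · obtain ⟨f, hf, hf0⟩ := (Submodule.ne_bot_iff W).1 hW0
        exact (Submodule.ne_bot_iff _).2 ⟨T f, ⟨f, hf, rfl⟩, fun h => hf0 (hTinj f (hWP hf) h)⟩
      · obtain ⟨f, hf, rfl⟩ := hg
        exact ⟨fun x => f (k • x), hWst k f hf, hT k f (hWP hf)⟩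
    have hPj := key P le_rfl hP0 hPst
    have h1 : Module.finrank ℚ (antiSpan G (Φ j)) ≤ Module.finrank ℚ P := by
      rw [← hPj]; exact Submodule.finrank_map_le T P
    have h2 : Module.finrank ℚ P ≤ Module.finrank ℚ (antiSpan G (Φ i)) := Submodule.finrank_mono hP
    have hPeq : P = antiSpan G (Φ i) := Submodule.eq_of_le_of_finrank_eq hP (by omega)
    obtain ⟨W, hWU, hW0, hWne, hWst⟩ := hred (by omega)
    have hWj := key W (hPeq ▸ hWU) hW0 hWst
    have h3 : Module.finrank ℚ (antiSpan G (Φ j)) ≤ Module.finrank ℚ W := by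
      rw [← hWj]; exact Submodule.finrank_map_le T W
    exact hWne (Submodule.eq_of_le_of_finrank_eq hWU (le_antisymm (Submodule.finrank_mono hWU) (by omega)))
  · intro P hP hPst T hT hTU hTinj
    by_contra hP0
    have hPeq : P = antiSpan G (Φ j) := hirr P hP hP0 (fun k f hf => hPst k f hf)
    -- `T` is injective on `P`, so `dim T(P) = dim P`
    have hinj : Function.Injective (T ∘ₗ P.subtype) := by
      intro f f' hff'
      apply Subtype.ext
      have h0 : T ((f : E j → ℚ) - f') = 0 := by
        rw [map_sub, sub_eq_zero]; exact hff'
      exact sub_eq_zero.1 (hTinj _ (P.sub_mem f.2 f'.2) h0)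
    have hrange : LinearMap.range (T ∘ₗ P.subtype) = P.map T := by
      rw [LinearMap.range_comp, Submodule.range_subtype]
    have hdimTP : Module.finrank ℚ (P.map T) = Module.finrank ℚ P := by
      rw [← hrange]; exact LinearMap.finrank_range_of_inj hinj
    have hTPle : P.map T ≤ antiSpan G (Φ i) := by
      rintro _ ⟨f, hf, rfl⟩; exact hTU f hf
    have h1 : Module.finrank ℚ (P.map T) ≤ Module.finrank ℚ (antiSpan G (Φ i)) := Submodule.finrank_mono hTPle
    have h2 : Module.finrank ℚ P = Module.finrank ℚ (antiSpan G (Φ j)) := by rw [hPeq]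
    have hTPeq : P.map T = antiSpan G (Φ i) := Submodule.eq_of_le_of_finrank_eq hTPle (by omega)
    obtain ⟨W, hWU, hW0, hWne, hWst⟩ := hred (by omega)
    -- the preimage of `W` in `P` is a proper non-zero stable subspace of the irreducible `U(Φ_j)`
    set W' : Submodule ℚ (E j → ℚ) := P ⊓ W.comap T with hW'_def
    have hW'st : ∀ (k : G) (f : E j → ℚ), f ∈ W' → (fun y => f (k • y)) ∈ W' := by
      intro k f hf
      refine ⟨hPst k f hf.1, ?_⟩
      change T (fun y => f (k • y)) ∈ W
      rw [hT k f hf.1]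
      exact hWst k (T f) hf.2
    have hW'0 : W' ≠ ⊥ := by
      obtain ⟨w, hwW, hw0⟩ := (Submodule.ne_bot_iff W).1 hW0
      have hwTP : w ∈ P.map T := by rw [hTPeq]; exact hWU hwW
      obtain ⟨f, hfP, rfl⟩ := hwTP
      refine (Submodule.ne_bot_iff _).2 ⟨f, ⟨hfP, hwW⟩, fun hf0 => hw0 ?_⟩
      rw [hf0, map_zero]
    have hW'eq : W' = antiSpan G (Φ j) := hirr W' (inf_le_left.trans hP) hW'0 hW'st
    apply hWne
    refine le_antisymm hWU ?_
    rw [← hTPeq]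
    rintro _ ⟨f, hfP, rfl⟩
    have hfW' : f ∈ W' := by rw [hW'eq, ← hPeq]; exact hfP
    exact hfW'.2

variable [Fintype I] [DecidableEq I] [Nonempty I] [∀ i, Nonempty (E i)]

/-- **Two slots, one irreducible, the other small or reducible: rank additivity** `rank(Φ₀, Φ₁) + 2 = rank Φ₀ +
rank Φ₁ + 1` (`Hg(A₀ × A₁) = Hg(A₀) × Hg(A₁)`). [cite: Gordon1999HodgeAVSurvey, §3 Theorem (1) and 7.7] -/
theorem typeRank_sigmaType_add_card_eq_of_irreducible_pair {ρ : G} {Φ : ∀ i, Set (E i)}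
    (h : ∀ i, IsCMTypeWith ρ (Φ i)) {i₀ i₁ : I} (hI : ∀ j, j = i₀ ∨ j = i₁) (h01 : i₀ ≠ i₁)
    (hirr : ∀ W : Submodule ℚ (E i₁ → ℚ), W ≤ antiSpan G (Φ i₁) → W ≠ ⊥ →
      (∀ (k : G) (f : E i₁ → ℚ), f ∈ W → (fun y => f (k • y)) ∈ W) → W = antiSpan G (Φ i₁))
    (hle : Module.finrank ℚ (antiSpan G (Φ i₀)) ≤ Module.finrank ℚ (antiSpan G (Φ i₁)))
    (hred : Module.finrank ℚ (antiSpan G (Φ i₀)) = Module.finrank ℚ (antiSpan G (Φ i₁)) →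
      ∃ W : Submodule ℚ (E i₀ → ℚ), W ≤ antiSpan G (Φ i₀) ∧ W ≠ ⊥ ∧ W ≠ antiSpan G (Φ i₀) ∧
        ∀ (k : G) (f : E i₀ → ℚ), f ∈ W → (fun y => f (k • y)) ∈ W) :
    typeRank G (sigmaType Φ) + Fintype.card I = (∑ i, typeRank G (Φ i)) + 1 := by
  have hp := pairwise_of_irreducible_of_finrank_le (Φ := Φ) hirr hle hred
  refine typeRank_sigmaType_add_card_eq_of_pairwise h fun i j hij => ?_
  rcases hI i with rfl | rfl <;> rcases hI j with rfl | rfl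
  · exact absurd rfl hij
  · exact hp.1
  · exact hp.2
  · exact absurd rfl hij

/-- **Two slots, one irreducible, the other small or reducible: the pair is nondegenerate iff both members are.**
[cite: Gordon1999HodgeAVSurvey, §3 Theorem and 7.6.1] -/
theorem typeRank_sigmaType_eq_iff_forall_of_irreducible_pair {ρ : G} {Φ : ∀ i, Set (E i)}
    (h : ∀ i, IsCMTypeWith ρ (Φ i)) {i₀ i₁ : I} (hI : ∀ j, j = i₀ ∨ j = i₁) (h01 : i₀ ≠ i₁)
    (hirr : ∀ W : Submodule ℚ (E i₁ → ℚ), W ≤ antiSpan G (Φ i₁) → W ≠ ⊥ →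
      (∀ (k : G) (f : E i₁ → ℚ), f ∈ W → (fun y => f (k • y)) ∈ W) → W = antiSpan G (Φ i₁))
    (hle : Module.finrank ℚ (antiSpan G (Φ i₀)) ≤ Module.finrank ℚ (antiSpan G (Φ i₁)))
    (hred : Module.finrank ℚ (antiSpan G (Φ i₀)) = Module.finrank ℚ (antiSpan G (Φ i₁)) →
      ∃ W : Submodule ℚ (E i₀ → ℚ), W ≤ antiSpan G (Φ i₀) ∧ W ≠ ⊥ ∧ W ≠ antiSpan G (Φ i₀) ∧
        ∀ (k : G) (f : E i₀ → ℚ), f ∈ W → (fun y => f (k • y)) ∈ W) :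
    typeRank G (sigmaType Φ) = Fintype.card (Σ i, E i) / 2 + 1 ↔
      ∀ i, typeRank G (Φ i) = Fintype.card (E i) / 2 + 1 := by
  have hp := pairwise_of_irreducible_of_finrank_le (Φ := Φ) hirr hle hred
  refine typeRank_sigmaType_eq_iff_forall_of_pairwise h fun i j hij => ?_
  rcases hI i with rfl | rfl <;> rcases hI j with rfl | rfl
  · exact absurd rfl hij
  · exact hp.1
  · exact hp.2
  · exact absurd rfl hij

end Irreducible

end Literature.NumberTheory.ComplexMultiplication
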